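import Summits.AtomisticToContinuum.Crystallization.Theorems.ContactSaturationLadderCoveringRung
import Summits.AtomisticToContinuum.Crystallization.Theorems.CrystalliteDichotomyCutPasteLaw
import Literature.MathematicalPhysics.StatisticalMechanics.LennardJonesThermodynamicLimitProofs
import Literature.Barriers.AtomisticToContinuum.IcosahedralClusters

/-!
# ContactSaturationLadderSparseCut — PART A (lines 1–227 of lens-1 g34 `land/ContactSaturationLadderSparseCut.lean`,
# sha256 8eb9f06912371e8673d477c2e909aad4937de9a4938ece956412bf513fe78345; split at the section-header boundaries for the 400-line rule, ONE namespace, linear import chain A → B → C;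
# landed by prover hand 1, gen 11, --supports stmt-AtomisticToContinuum-30303: declarations byte-identical, one gate-forced delta = docstrings
# added to the undocumented weaker-by-name / monotonicity lemmas)

Original module docstring (whole file):


# ContactSaturationLadderSparseCut — THE COORDINATION CUT of the band piece BAND_F(1,2) beneath the residual `NoLooseChunks` of crux
# `LooseTextureRung`: marker-generic EXACT three-way split of NLC_F(δ₁), the chunk-removal (cut-and-paste) kernel, the competitor door,
# the coordination ladder (helper, supports item 30303; lens-1 g34 land twin of node §45 `SparseCut45` §45.1–§45.3 + §45.5, kernels only)

What is here (0 sorry; every split an `iff`, 0 EQUIV):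
* §45.1 MARKER KERNEL over the tree's `SiteMarker` (`ContactSaturationLadderChunkDoor`): `UnmarkedChunkAtF/UnmarkedChunkExclusionF F δ` («no large
  all-δ-looseF 2-void-free chunks WITHOUT an F-marked particle»), the looseness-free `UnmarkedChunkExclusion F`, `CoMarkedBandChunkAtF/CoMarkedBandExclusionF F δ₁ δ₂`
  (the band piece restricted to chunks in which the F-marked particles are ALSO dense); weaker-by-name lemmas; monotonicity in F and δ;
  ★ `noLooseChunksF_iff_unmarked_comarked : δ₁ ≤ δ₂ → (NoLooseChunksF δ₁ ↔ Unmarked F δ₁ ∧ CoMarked F δ₁ δ₂ ∧ NoLooseChunksF δ₂)` and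
  `bandExclusionF_iff_unmarked_comarked : NoLooseChunksF δ₂ → (BandExclusionF δ₁ δ₂ ↔ Unmarked F δ₁ ∧ CoMarked F δ₁ δ₂)`.
* §45.2 SURGERY KERNEL: `ChunkRemovalFloor F α D` (ONE GS-free N-uniform inequality: removal floor `D_A + 2 I_A ≥ −(2α·#A + D r²)` for the particles A of an
  F-free void-free doubled window), `Competitor γ` (`E(n) ≤ (−γ+ε) n` eventually), ★ `unmarkedChunkExclusion_of_floor : ChunkRemovalFloor F α D → Competitor γ →
  α < γ → UnmarkedChunkExclusion F` (cut and paste: tree `pairSum_add_two_mul_cross_le_groundStateEnergy`, filling `cube_le_eight_mul_card_of_voidFree`),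
  `competitor_of_cluster` (Fekete over the tree's `subadditive_groundStateEnergy_lennardJones`: ONE finite cluster with `E(n₁) ≤ −γ n₁` certifies γ),
  `competitor_eighth : Competitor (1/8)` (tree `groundStateEnergy_lennardJones_four`).
* §45.3 THE COORDINATION MARKER `coordMarker m` (≥ m others within 7/5 = (1+1)·(7/10)); `uniformlyTightF_one_floor_iff` (1-tightness at the floor scale ⟺ every
  particle of the 5-ball is 12-coordinated); SPARSE antitone / COMARKED monotone in m; `sparse_zero`, `comarked_zero_iff`, `sparse_of_floor`,
  `noLooseChunksF_one_iff_coord m : NoLooseChunksF 1 ↔ SPARSE(m;1) ∧ COMARKED(m;1,2) ∧ NoLooseChunksF 2`.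
* §45.5 `ShellSumBound s R S` and its crude tree instance `shellSumBound_crude : ShellSumBound s R (250 s⁻⁶)`.

No `instance`, no `notation`, no `axiom`, no `sorry`.  Source: lens-1 g34 node `LooseTextureRung_node_g34.lean` §45 (the node keeps the same declarations in
its Theses-side namespace plus the node-side §45.4 compositions to `LooseTextureRung`).  Imports only landed tree modules.

-/

noncomputable section

namespace Summit.AtomisticToContinuum.Crystallization.Theorems.ContactSaturationLadderSparseCut

section SparseCut45


open scoped BigOperators Classical
open Metric Filter
open Literature.MathematicalPhysics.StatisticalMechanics (lennardJones IsGroundState interactionEnergy groundStateEnergy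
  groundStateEnergy_lennardJones_le subadditive_groundStateEnergy_lennardJones sum_inv_pow_six_le)
open Summit.AtomisticToContinuum.Crystallization.Theorems.ContactSaturationLadderHaloCount (voidAdjSet)
open Summit.AtomisticToContinuum.Crystallization.Theorems.ContactSaturationLadderChunkDoor (NoLooseChunks SiteMarker gs_separated
  seven_tenths_le_gsMinDist cube_le_eight_mul_card_of_voidFree)
open Summit.AtomisticToContinuum.Crystallization.Theorems.ContactSaturationLadderToleranceFloor (UniformlyTightF looseSetF NoLooseChunkAtF
  NoLooseChunksF BandChunkAtF BandExclusionF bandExclusionF_of_noLooseChunksF noLooseChunksF_mono noLooseChunksF_of_noLooseChunks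
  looseSetF_anti_slack noLooseChunksF_iff_band noLooseChunksF_of_band)
open Summit.AtomisticToContinuum.Crystallization.Theorems.CrystalliteDichotomyCutPasteLaw (pairSum_add_two_mul_cross_le_groundStateEnergy)

/-! ### §45.1 Marker-generic pieces: UNMARKED chunk exclusion and the CO-MARKED band -/

/-- **`UnmarkedChunkAtF F δ r`** — no Lennard-Jones ground state has an all-`δ`-looseF, 2-void-free doubled window `B(c,2r)` with
occupied inner window in which NO particle is `F`-marked. [GS-side · one radius] -/
def UnmarkedChunkAtF (F : SiteMarker) (δ r : ℝ) : Prop :=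
  ∀ (N : ℕ) (y : Fin N → EuclideanSpace ℝ (Fin 3)), IsGroundState lennardJones y →
    ∀ c : EuclideanSpace ℝ (Fin 3),
      (∀ i : Fin N, dist (y i) c ≤ 2 * r → i ∈ looseSetF δ y) →
        (∀ i : Fin N, dist (y i) c ≤ 2 * r → i ∉ voidAdjSet 2 y) →
          (∀ i : Fin N, dist (y i) c ≤ 2 * r → i ∉ F N y) → ∀ i : Fin N, r < dist (y i) c

/-- **`UnmarkedChunkExclusionF F δ`** — «no large all-`δ`-looseF void-free `F`-FREE chunks», eventually in the radius. -/
def UnmarkedChunkExclusionF (F : SiteMarker) (δ : ℝ) : Prop :=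
  ∃ r₀ : ℝ, ∀ r : ℝ, r₀ ≤ r → UnmarkedChunkAtF F δ r

/-- **`UnmarkedChunkAt F r`** — the LOOSENESS-FREE form (the attack target): no Lennard-Jones ground state has a 2-void-free doubled
window `B(c,2r)` with occupied inner window in which no particle is `F`-marked. -/
def UnmarkedChunkAt (F : SiteMarker) (r : ℝ) : Prop :=
  ∀ (N : ℕ) (y : Fin N → EuclideanSpace ℝ (Fin 3)), IsGroundState lennardJones y →
    ∀ c : EuclideanSpace ℝ (Fin 3),
      (∀ i : Fin N, dist (y i) c ≤ 2 * r → i ∉ voidAdjSet 2 y) →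
        (∀ i : Fin N, dist (y i) c ≤ 2 * r → i ∉ F N y) → ∀ i : Fin N, r < dist (y i) c

/-- **`UnmarkedChunkExclusion F`** — the looseness-free exclusion, eventually in the radius. -/
def UnmarkedChunkExclusion (F : SiteMarker) : Prop :=
  ∃ r₀ : ℝ, ∀ r : ℝ, r₀ ≤ r → UnmarkedChunkAt F r

/-- **`CoMarkedBandChunkAtF F δ₁ δ₂ ρ' ρ'' r`** — the band piece `BandChunkAtF δ₁ δ₂ ρ' r` restricted to chunks in which, additionally,
the `F`-MARKED particles are `2ρ''`-dense. [GS-side · one radius · two density radii] -/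
def CoMarkedBandChunkAtF (F : SiteMarker) (δ₁ δ₂ ρ' ρ'' r : ℝ) : Prop :=
  ∀ (N : ℕ) (y : Fin N → EuclideanSpace ℝ (Fin 3)), IsGroundState lennardJones y →
    ∀ c : EuclideanSpace ℝ (Fin 3),
      (∀ i : Fin N, dist (y i) c ≤ 2 * r → i ∈ looseSetF δ₁ y) →
        (∀ i : Fin N, dist (y i) c ≤ 2 * r → i ∉ voidAdjSet 2 y) →
          (∀ c' : EuclideanSpace ℝ (Fin 3), dist c' c ≤ 2 * r - 2 * ρ' → (∃ i : Fin N, dist (y i) c' ≤ ρ') →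
              ∃ j : Fin N, dist (y j) c' ≤ 2 * ρ' ∧ j ∉ looseSetF δ₂ y) →
            (∀ c' : EuclideanSpace ℝ (Fin 3), dist c' c ≤ 2 * r - 2 * ρ'' → (∃ i : Fin N, dist (y i) c' ≤ ρ'') →
                ∃ j : Fin N, dist (y j) c' ≤ 2 * ρ'' ∧ j ∈ F N y) →
              ∀ i : Fin N, r < dist (y i) c

/-- **`CoMarkedBandExclusionF F δ₁ δ₂`** — for all density radii `ρ', ρ'' ≥ 0`, eventually in the chunk radius. -/
def CoMarkedBandExclusionF (F : SiteMarker) (δ₁ δ₂ : ℝ) : Prop :=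
  ∀ ρ' : ℝ, 0 ≤ ρ' → ∀ ρ'' : ℝ, 0 ≤ ρ'' → ∃ r₀ : ℝ, ∀ r : ℝ, r₀ ≤ r → CoMarkedBandChunkAtF F δ₁ δ₂ ρ' ρ'' r

/-! #### Weaker by name -/

/-- Weaker by name: no loose chunk at radius `r` (`NoLooseChunkAtF δ r`) gives the UNMARKED chunk statement for any marker `F`. [folklore] -/
theorem unmarkedChunkAtF_of_noLooseChunkAtF (F : SiteMarker) {δ r : ℝ} (h : NoLooseChunkAtF δ r) :
    UnmarkedChunkAtF F δ r :=
  fun N y hy c hl hv _ => h N y hy c hl hv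

/-- Weaker by name: `NoLooseChunksF δ ⟹ UnmarkedChunkExclusionF F δ` for any marker `F`. [folklore] -/
theorem unmarkedChunkExclusionF_of_noLooseChunksF (F : SiteMarker) {δ : ℝ} (h : NoLooseChunksF δ) :
    UnmarkedChunkExclusionF F δ := by
  obtain ⟨r₀, h₀⟩ := h
  exact ⟨r₀, fun r hr => unmarkedChunkAtF_of_noLooseChunkAtF F (h₀ r hr)⟩

/-- Weaker by name: `NoLooseChunks ⟹ UnmarkedChunkExclusionF F δ` for `δ ≥ 3/50`. [folklore] -/
theorem unmarkedChunkExclusionF_of_noLooseChunks (F : SiteMarker) {δ : ℝ} (hδ : 3 / 50 ≤ δ) (h : NoLooseChunks) :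
    UnmarkedChunkExclusionF F δ :=
  unmarkedChunkExclusionF_of_noLooseChunksF F (noLooseChunksF_of_noLooseChunks hδ h)

/-- The looseness-free unmarked statement at radius `r` implies the `δ`-loose one. [folklore] -/
theorem unmarkedChunkAtF_of_unmarkedChunkAt (F : SiteMarker) (δ : ℝ) {r : ℝ} (h : UnmarkedChunkAt F r) :
    UnmarkedChunkAtF F δ r :=
  fun N y hy c _ hv hF => h N y hy c hv hF

/-- `UnmarkedChunkExclusion F ⟹ UnmarkedChunkExclusionF F δ` for every `δ`. [folklore] -/
theorem unmarkedChunkExclusionF_of_unmarkedChunkExclusion (F : SiteMarker) (δ : ℝ) (h : UnmarkedChunkExclusion F) :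
    UnmarkedChunkExclusionF F δ := by
  obtain ⟨r₀, h₀⟩ := h
  exact ⟨r₀, fun r hr => unmarkedChunkAtF_of_unmarkedChunkAt F δ (h₀ r hr)⟩

/-- Weaker by name: a band chunk statement at radius `r` gives the CO-MARKED one for any marker `F`. [folklore] -/
theorem coMarkedBandChunkAtF_of_bandChunkAtF (F : SiteMarker) {δ₁ δ₂ ρ' ρ'' r : ℝ} (h : BandChunkAtF δ₁ δ₂ ρ' r) :
    CoMarkedBandChunkAtF F δ₁ δ₂ ρ' ρ'' r :=
  fun N y hy c hl hv hT _ => h N y hy c hl hv hT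

/-- Weaker by name: `BandExclusionF δ₁ δ₂ ⟹ CoMarkedBandExclusionF F δ₁ δ₂`. [folklore] -/
theorem coMarkedBandExclusionF_of_bandExclusionF (F : SiteMarker) {δ₁ δ₂ : ℝ} (h : BandExclusionF δ₁ δ₂) :
    CoMarkedBandExclusionF F δ₁ δ₂ := by
  intro ρ' hρ' ρ'' _
  obtain ⟨r₀, h₀⟩ := h ρ' hρ'
  exact ⟨r₀, fun r hr => coMarkedBandChunkAtF_of_bandChunkAtF F (h₀ r hr)⟩

/-- `NoLooseChunksF δ₁ ⟹ CoMarkedBandExclusionF F δ₁ δ₂` (through the band piece). [folklore] -/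
theorem coMarkedBandExclusionF_of_noLooseChunksF (F : SiteMarker) {δ₁ δ₂ : ℝ} (h : NoLooseChunksF δ₁) :
    CoMarkedBandExclusionF F δ₁ δ₂ :=
  coMarkedBandExclusionF_of_bandExclusionF F (bandExclusionF_of_noLooseChunksF h)

/-- `NoLooseChunks ⟹ CoMarkedBandExclusionF F δ₁ δ₂` for `δ₁ ≥ 3/50`. [folklore] -/
theorem coMarkedBandExclusionF_of_noLooseChunks (F : SiteMarker) {δ₁ δ₂ : ℝ} (hδ : 3 / 50 ≤ δ₁) (h : NoLooseChunks) :
    CoMarkedBandExclusionF F δ₁ δ₂ :=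
  coMarkedBandExclusionF_of_noLooseChunksF F (noLooseChunksF_of_noLooseChunks hδ h)

/-! #### Monotonicity in the marker and in the tolerance -/

/-- Monotonicity in the marker: enlarging the marker (`F ⊆ G` pointwise) preserves `UnmarkedChunkAtF`. [folklore] -/
theorem unmarkedChunkAtF_mono_marker {F G : SiteMarker} (hFG : ∀ (N : ℕ) (y : Fin N → EuclideanSpace ℝ (Fin 3)), F N y ⊆ G N y)
    {δ r : ℝ} (h : UnmarkedChunkAtF F δ r) : UnmarkedChunkAtF G δ r :=
  fun N y hy c hl hv hG => h N y hy c hl hv fun i hi hiF => hG i hi (hFG N y hiF)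

/-- Monotonicity in the marker: `F ⊆ G ⟹ (UnmarkedChunkExclusionF F δ → UnmarkedChunkExclusionF G δ)`. [folklore] -/
theorem unmarkedChunkExclusionF_mono_marker {F G : SiteMarker}
    (hFG : ∀ (N : ℕ) (y : Fin N → EuclideanSpace ℝ (Fin 3)), F N y ⊆ G N y) {δ : ℝ} (h : UnmarkedChunkExclusionF F δ) :
    UnmarkedChunkExclusionF G δ := by
  obtain ⟨r₀, h₀⟩ := h
  exact ⟨r₀, fun r hr => unmarkedChunkAtF_mono_marker hFG (h₀ r hr)⟩

/-- Monotonicity in the marker for the looseness-free statement `UnmarkedChunkAt`. [folklore] -/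
theorem unmarkedChunkAt_mono_marker {F G : SiteMarker} (hFG : ∀ (N : ℕ) (y : Fin N → EuclideanSpace ℝ (Fin 3)), F N y ⊆ G N y)
    {r : ℝ} (h : UnmarkedChunkAt F r) : UnmarkedChunkAt G r :=
  fun N y hy c hv hG => h N y hy c hv fun i hi hiF => hG i hi (hFG N y hiF)

/-- Antitonicity in the marker: the CO-MARKED band chunk statement for `G ⊇ F` gives the one for `F`. [folklore] -/
theorem coMarkedBandChunkAtF_anti_marker {F G : SiteMarker}
    (hFG : ∀ (N : ℕ) (y : Fin N → EuclideanSpace ℝ (Fin 3)), F N y ⊆ G N y) {δ₁ δ₂ ρ' ρ'' r : ℝ}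
    (h : CoMarkedBandChunkAtF G δ₁ δ₂ ρ' ρ'' r) : CoMarkedBandChunkAtF F δ₁ δ₂ ρ' ρ'' r :=
  fun N y hy c hl hv hT hF => h N y hy c hl hv hT fun c' hc' hocc => by
    obtain ⟨j, hj, hjF⟩ := hF c' hc' hocc
    exact ⟨j, hj, hFG N y hjF⟩

/-- Antitonicity in the marker: `F ⊆ G ⟹ (CoMarkedBandExclusionF G δ₁ δ₂ → CoMarkedBandExclusionF F δ₁ δ₂)`. [folklore] -/
theorem coMarkedBandExclusionF_anti_marker {F G : SiteMarker}
    (hFG : ∀ (N : ℕ) (y : Fin N → EuclideanSpace ℝ (Fin 3)), F N y ⊆ G N y) {δ₁ δ₂ : ℝ}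
    (h : CoMarkedBandExclusionF G δ₁ δ₂) : CoMarkedBandExclusionF F δ₁ δ₂ := by
  intro ρ' hρ' ρ'' hρ''
  obtain ⟨r₀, h₀⟩ := h ρ' hρ' ρ'' hρ''
  exact ⟨r₀, fun r hr => coMarkedBandChunkAtF_anti_marker hFG (h₀ r hr)⟩

/-- Monotonicity in the tolerance: `δ ≤ δ' ⟹ (UnmarkedChunkAtF F δ r → UnmarkedChunkAtF F δ' r)`. [folklore] -/
theorem unmarkedChunkAtF_mono_slack {F : SiteMarker} {δ δ' r : ℝ} (hδ : δ ≤ δ') (h : UnmarkedChunkAtF F δ r) :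
    UnmarkedChunkAtF F δ' r :=
  fun N y hy c hl hv hF => h N y hy c (fun i hi => looseSetF_anti_slack hδ y (hl i hi)) hv hF

/-- Monotonicity in the tolerance: `δ ≤ δ' ⟹ (UnmarkedChunkExclusionF F δ → UnmarkedChunkExclusionF F δ')`. [folklore] -/
theorem unmarkedChunkExclusionF_mono_slack {F : SiteMarker} {δ δ' : ℝ} (hδ : δ ≤ δ') (h : UnmarkedChunkExclusionF F δ) :
    UnmarkedChunkExclusionF F δ' := by
  obtain ⟨r₀, h₀⟩ := h
  exact ⟨r₀, fun r hr => unmarkedChunkAtF_mono_slack hδ (h₀ r hr)⟩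

/-! #### THE MARKER KERNEL: the exact three-way split of NLC_F(δ₁) through ANY marker -/

/-- **KERNEL A (nested recentring dichotomy)**: UNMARKED(F;δ₁) ∧ COMARKED(F;δ₁,δ₂) ∧ NLC_F(δ₂) ⟹ NLC_F(δ₁).  In a large all-`δ₁`-looseF
void-free chunk either some sub-window with occupied inner ball is `F`-free (excluded by UNMARKED), or some sub-window is all-`δ₂`-looseF
(excluded by NLC_F(δ₂)), or both the `F`-marked and the `δ₂`-tightF particles are dense (excluded by COMARKED). -/
theorem noLooseChunksF_of_unmarked_comarked {F : SiteMarker} {δ₁ δ₂ : ℝ} (hU : UnmarkedChunkExclusionF F δ₁)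
    (hC : CoMarkedBandExclusionF F δ₁ δ₂) (hN : NoLooseChunksF δ₂) : NoLooseChunksF δ₁ := by
  obtain ⟨rU, hrU⟩ := hU
  obtain ⟨ρ₂, h₂⟩ := hN
  obtain ⟨r₀, hr₀⟩ := hC (max ρ₂ 0) (le_max_right _ _) (max rU 0) (le_max_right _ _)
  refine ⟨r₀, fun r hr N y hy c hl hv => hr₀ r hr N y hy c hl hv ?_ ?_⟩
  · intro c' hc' hocc
    by_contra hno
    push Not at hno
    have hch : ∀ i : Fin N, max ρ₂ 0 < dist (y i) c' :=
      h₂ (max ρ₂ 0) (le_max_left _ _) N y hy c' (fun j hj => hno j hj) fun j hj => hv j (by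
        have := dist_triangle (y j) c' c
        linarith)
    obtain ⟨i, hi⟩ := hocc
    exact absurd (hch i) (not_lt.mpr hi)
  · intro c' hc' hocc
    by_contra hno
    push Not at hno
    have hch : ∀ i : Fin N, max rU 0 < dist (y i) c' :=
      hrU (max rU 0) (le_max_left _ _) N y hy c'
        (fun j hj => hl j (by
          have := dist_triangle (y j) c' c
          linarith))
        (fun j hj => hv j (by
          have := dist_triangle (y j) c' c
          linarith))
        fun j hj => hno j hj
    obtain ⟨i, hi⟩ := hocc
    exact absurd (hch i) (not_lt.mpr hi)

/-- **EXACT THREE-WAY SPLIT (0 EQUIV)**: for `δ₁ ≤ δ₂` and EVERY marker `F`,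
`NLC_F(δ₁) ⟺ UNMARKED(F;δ₁) ∧ COMARKED(F;δ₁,δ₂) ∧ NLC_F(δ₂)`. -/
theorem noLooseChunksF_iff_unmarked_comarked (F : SiteMarker) {δ₁ δ₂ : ℝ} (hδ : δ₁ ≤ δ₂) :
    NoLooseChunksF δ₁ ↔ UnmarkedChunkExclusionF F δ₁ ∧ CoMarkedBandExclusionF F δ₁ δ₂ ∧ NoLooseChunksF δ₂ :=
  ⟨fun h => ⟨unmarkedChunkExclusionF_of_noLooseChunksF F h, coMarkedBandExclusionF_of_noLooseChunksF F h,
      noLooseChunksF_mono hδ h⟩,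
    fun h => noLooseChunksF_of_unmarked_comarked h.1 h.2.1 h.2.2⟩

/-- **THE BAND PIECE SPLITS (given the next grade)**: under NLC_F(δ₂) (any δ₁, δ₂),
`BAND_F(δ₁,δ₂) ⟺ UNMARKED(F;δ₁) ∧ COMARKED(F;δ₁,δ₂)`. -/
theorem bandExclusionF_iff_unmarked_comarked (F : SiteMarker) {δ₁ δ₂ : ℝ} (hN : NoLooseChunksF δ₂) :
    BandExclusionF δ₁ δ₂ ↔ UnmarkedChunkExclusionF F δ₁ ∧ CoMarkedBandExclusionF F δ₁ δ₂ := by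
  constructor
  · intro hB
    have h := noLooseChunksF_of_band hN hB
    exact ⟨unmarkedChunkExclusionF_of_noLooseChunksF F h, coMarkedBandExclusionF_of_bandExclusionF F hB⟩
  · intro h
    exact bandExclusionF_of_noLooseChunksF (noLooseChunksF_of_unmarked_comarked h.1 h.2 hN)

end SparseCut45

end Summit.AtomisticToContinuum.Crystallization.Theorems.ContactSaturationLadderSparseCut
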